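import Literature.Computability.AlgebraicComplexity.GroupTheoreticMatMulProofs
import Literature.Computability.AlgebraicComplexity.GroupAlgebraTensor
import Literature.Computability.AlgebraicComplexity.BorderRankCW
import Literature.Computability.AlgebraicComplexity.CoppersmithWinograd1990
import HarnessLib

/-!
# Abelian realizations of the `xyz` pattern bound the rank of Kronecker powers of `T_{cw,2}`

New rung for the asymptotic-rank line to `ω(ℂ) = 2` (in-tree: `matrixMultiplication_of_cw_two`,
`CoppersmithWinograd1990_asymptoticRank_form_holds`: were `R(T_{cw,2}^{⊠N}) = O(3^{(1+ε)N})` for all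
`ε > 0`, then `ω(ℂ) = 2`).

* `T_xyz` — the `3×3×3` tensor with entry `1` at the six permutations of `(0,1,2)` (the
  polarisation of the monomial `xyz`; written as a literal lambda, no new definition);
  `xyzTensor_restrictsTo_cwTensor` — over `ℂ`, `T_{cw,2}` is a restriction of it (in fact
  isomorphic: `3X₀(X₁²+X₂²) = 3X₀(X₁+iX₂)(X₁-iX₂)`), via an explicit `3×3` matrix; hence `R(T_{cw,2}^{⊠N}) ≤ R(T_xyz^{⊠N})` for every `N`
  (`tensorRank_kroneckerPow_cwTensor_le_xyz`).
* an **abelian realization** of the support of `T_xyz^{⊠N}`: a map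
  `s : (Fin N → Fin 3) → H` into an abelian group and `u : H` with
  `s a + s b + s c = u ↔ (a, b, c) ∈ supp T_xyz^{⊠N}` (coordinatewise pairwise distinct).
* `tensorRank_indicator₃_le_card` — for maps `α β γ : ι → H` into a finite abelian group,
  the tensor `[α a + β b + γ c = u]` is a coordinate restriction of the structure tensor of `ℂ[H]`,
  so its rank is `≤ |H|` (characters; in-tree `tensorRank_addGroupAlgTensor_le`).
* `tensorRank_kroneckerPow_cwTensor_le_card_of_realization` — **the rung**: an abelian
  realization of `T_xyz^{⊠N}` in `H` gives `R(T_{cw,2}^{⊠N}) ≤ |H|`; the same for the tree's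
  inline form of the Kronecker power (`tensorRank_cwTwoPow_le_card_of_realization`).
* `isXYZRealization_prod` — the product realization in `(ℤ/2 × ℤ/2)^N` (non-vacuity), recovering
  `R(T_{cw,2}^{⊠N}) ≤ 4^N` (`tensorRank_kroneckerPow_cwTensor_two_le_four_pow`).

A realization with `|H| < 4^N` for some `N` would give `R̃(T_{cw,2}) < 4 = bR(T_{cw,2})`; none exists
for `N ≤ 3` (exhaustive search, solo-blind s1), the question is open for `N ≥ 4`.
-/

set_option linter.dupNamespace false

noncomputable section

open scoped BigOperators

open Literature.Computability.AlgebraicComplexity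

namespace Summit.MatrixMultiplication.MatrixMultiplication.Theorems

/-! ## The `xyz` tensor and its relation to `T_{cw,2}` -/

/- `T_xyz ∈ (ℂ^3)^{⊗3}`: entry `1` at `(a,b,c)` iff `a, b, c` are pairwise distinct (the six
permutations of `(0,1,2)`), i.e. the symmetric tensor of the monomial `6·xyz`.  Kept as the literal
lambda below (local notation `xyzT`), so that no new definition enters the tree with this file. -/
set_option quotPrecheck false in
local notation "xyzT" =>
  (fun a b c : Fin 3 => if a ≠ b ∧ b ≠ c ∧ a ≠ c then (1 : ℂ) else 0)

/- The change of basis `X₀ ↦ X₀/2`, `X₁ ↦ X₁ + i X₂`, `X₂ ↦ X₁ - i X₂` (columns), as a matrix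
`(row = T_{cw,2} index, column = T_xyz index)`; local notation `xyzToCw`. -/
local notation "xyzToCw" =>
  (fun a' a : Fin 3 => ![![(1 / 2 : ℂ), 0, 0], ![0, 1, 1], ![0, Complex.I, -Complex.I]] a' a)

/- The one-coordinate realization `0 ↦ (0,0)`, `1 ↦ (1,0)`, `2 ↦ (0,1)` in `ℤ/2 × ℤ/2`
(target `(1,1)`); local notation `kleinEmb`. -/
local notation "kleinEmb" => (![((0 : ZMod 2), (0 : ZMod 2)), (1, 0), (0, 1)] : Fin 3 → ZMod 2 × ZMod 2)

/-- Contracting against `T_xyz` = summing over the six permutations. [new] -/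
theorem sum_xyzTensor (A B C : Fin 3 → ℂ) :
    ∑ a, ∑ b, ∑ c, A a * B b * C c * xyzT a b c =
      A 0 * B 1 * C 2 + A 0 * B 2 * C 1 + A 1 * B 0 * C 2 +
        A 1 * B 2 * C 0 + A 2 * B 0 * C 1 + A 2 * B 1 * C 0 := by
  simp +decide [Fin.sum_univ_three]
  ring

/-- **`T_{cw,2} ≤ T_xyz` over `ℂ`**: `T_{cw,2} = T_xyz ∘ (M, M, M)` with `M = xyzToCw`
(`3X₀(X₁² + X₂²) = 6 · (X₀/2)(X₁ + iX₂)(X₁ - iX₂)`). [new] -/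
theorem xyzTensor_restrictsTo_cwTensor : TensorRestrictsTo xyzT (cwTensor ℂ 2) := by
  refine ⟨xyzToCw, xyzToCw, xyzToCw, fun a' b' c' => ?_⟩
  rw [sum_xyzTensor]
  fin_cases a' <;> fin_cases b' <;> fin_cases c' <;>
    simp +decide [cwTensor] <;> ring_nf <;> simp [Complex.I_sq]

/-- Hence `R(T_{cw,2}^{⊠N}) ≤ R(T_xyz^{⊠N})` for every `N`. [new] -/
theorem tensorRank_kroneckerPow_cwTensor_le_xyz (N : ℕ) :
    tensorRank (kroneckerPow (cwTensor ℂ 2) N) ≤ tensorRank (kroneckerPow xyzT N) :=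
  (xyzTensor_restrictsTo_cwTensor.kroneckerPow N).tensorRank_le

/-! ## Indicator tensors of abelian groups have rank at most `|H|` -/

section Indicator

variable {ι : Type*} {H : Type*} [AddCommGroup H] [Fintype H]
  [DecidableEq H]

/-- **`R([α a + β b + γ c = u]) ≤ |H|`**: the tensor `(a,b,c) ↦ [α a + β b + γ c = u]` is the
coordinate restriction of the structure tensor `(z,x,y) ↦ [x + y = z]` of `ℂ[H]` along
`a ↦ u - α a`, `β`, `γ`, whose rank is `≤ |H|` by the character decomposition. [new] -/
theorem tensorRank_indicator₃_le_card (α β γ : ι → H) (u : H) :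
    tensorRank (fun a b c : ι => if α a + β b + γ c = u then (1 : ℂ) else 0) ≤ Fintype.card H := by
  have heq : (fun a b c : ι => if α a + β b + γ c = u then (1 : ℂ) else 0) =
      fun a b c => (fun z x y : H => if x + y = z then (1 : ℂ) else 0) (u - α a) (β b) (γ c) := by
    funext a b c
    have : (β b + γ c = u - α a) ↔ (α a + β b + γ c = u) := by
      rw [eq_sub_iff_add_eq]
      constructor <;> intro h <;> · rw [← h]; abel
    simp only [this]
  rw [heq]
  exact (tensorRestrictsTo_precomp (fun z x y : H => if x + y = z then (1 : ℂ) else 0)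
    (fun a => u - α a) β γ).tensorRank_le.trans (tensorRank_addGroupAlgTensor_le H)

end Indicator

/-! ## Abelian realizations of the `xyz` pattern -/

/- An **abelian realization** of (the support of) `T_xyz^{⊠N}` in an abelian group `H` is a map
`s : (Fin N → Fin 3) → H` and `u : H` with `s a + s b + s c = u` exactly on the support (all
coordinates pairwise distinct); we keep it as the explicit hypothesis
`∀ a b c, s a + s b + s c = u ↔ ∀ i, a i ≠ b i ∧ b i ≠ c i ∧ a i ≠ c i`. -/

/-- Under a realization, `T_xyz^{⊠N}` IS the indicator tensor `[s a + s b + s c = u]`. [new] -/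
theorem kroneckerPow_xyzTensor_eq_of_realization {N : ℕ} {H : Type*} [AddCommGroup H]
    [DecidableEq H] {s : (Fin N → Fin 3) → H} {u : H}
    (h : ∀ a b c : Fin N → Fin 3, s a + s b + s c = u ↔ ∀ i, a i ≠ b i ∧ b i ≠ c i ∧ a i ≠ c i) :
    kroneckerPow xyzT N = fun a b c => if s a + s b + s c = u then (1 : ℂ) else 0 := by
  funext a b c
  rw [kroneckerPow_apply]
  by_cases hall : ∀ i, a i ≠ b i ∧ b i ≠ c i ∧ a i ≠ c i
  · rw [if_pos ((h a b c).2 hall)]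
    exact Finset.prod_eq_one fun i _ => by simp [hall i]
  · rw [if_neg fun hs => hall ((h a b c).1 hs)]
    obtain ⟨i, hi⟩ := not_forall.mp hall
    exact Finset.prod_eq_zero (Finset.mem_univ i) (if_neg hi)

/-- **The rung.** An abelian realization of `T_xyz^{⊠N}` in a finite abelian group `H` gives
`R(T_{cw,2}^{⊠N}) ≤ |H|`. [new] -/
theorem tensorRank_kroneckerPow_cwTensor_le_card_of_realization {N : ℕ} {H : Type*}
    [AddCommGroup H] [Fintype H] [DecidableEq H] (s : (Fin N → Fin 3) → H) (u : H)
    (h : ∀ a b c : Fin N → Fin 3, s a + s b + s c = u ↔ ∀ i, a i ≠ b i ∧ b i ≠ c i ∧ a i ≠ c i) :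
    tensorRank (kroneckerPow (cwTensor ℂ 2) N) ≤ Fintype.card H := by
  refine (tensorRank_kroneckerPow_cwTensor_le_xyz N).trans ?_
  rw [kroneckerPow_xyzTensor_eq_of_realization h]
  exact tensorRank_indicator₃_le_card s s s u

/-- The tree's inline form of `T_{cw,2}^{⊠N}` (as in `CoppersmithWinograd1990_asymptoticRank_form`,
`q = 2`) is `kroneckerPow (cwTensor ℂ 2) N`. [new] -/
theorem cwTwoPow_inline_eq (N : ℕ) :
    (fun a b c : Fin N → Fin 3 => ∏ i,
        (if (a i = 0 ∧ b i = c i ∧ b i ≠ 0) ∨ (b i = 0 ∧ a i = c i ∧ a i ≠ 0) ∨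
          (c i = 0 ∧ a i = b i ∧ a i ≠ 0) then (1 : ℂ) else 0)) =
      kroneckerPow (cwTensor ℂ 2) N := rfl

/-- The rung in the tree's inline form: a realization in `H` bounds the rank of the `N`-th
Kronecker power of `T_{cw,2}` written on `(Fin N → Fin 3)³` by `|H|`. [new] -/
theorem tensorRank_cwTwoPow_le_card_of_realization {N : ℕ} {H : Type*} [AddCommGroup H]
    [Fintype H] [DecidableEq H] (s : (Fin N → Fin 3) → H) (u : H)
    (h : ∀ a b c : Fin N → Fin 3, s a + s b + s c = u ↔ ∀ i, a i ≠ b i ∧ b i ≠ c i ∧ a i ≠ c i) :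
    tensorRank (K := ℂ) (fun a b c : Fin N → Fin 3 => ∏ i,
        (if (a i = 0 ∧ b i = c i ∧ b i ≠ 0) ∨ (b i = 0 ∧ a i = c i ∧ a i ≠ 0) ∨
          (c i = 0 ∧ a i = b i ∧ a i ≠ 0) then (1 : ℂ) else 0)) ≤ Fintype.card H := by
  rw [cwTwoPow_inline_eq]
  exact tensorRank_kroneckerPow_cwTensor_le_card_of_realization s u h

/-! ## Non-vacuity: the product realization in `(ℤ/2 × ℤ/2)^N` -/

/-- In `ℤ/2 × ℤ/2`, three images of `0 ↦ (0,0)`, `1 ↦ (1,0)`, `2 ↦ (0,1)` sum to `(1,1)` iff the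
three points of `Fin 3` are pairwise distinct (the one-coordinate realization; `27` cases). [new] -/
theorem kleinEmbedding_sum_eq_iff (x y z : Fin 3) :
    kleinEmb x + kleinEmb y + kleinEmb z = (1, 1) ↔ (x ≠ y ∧ y ≠ z ∧ x ≠ z) := by
  revert x y z
  decide

/-- **The product realization** of `T_xyz^{⊠N}` in `(ℤ/2 × ℤ/2)^N`. [new] -/
theorem isXYZRealization_prod (N : ℕ) (a b c : Fin N → Fin 3) :
    ((fun i => kleinEmb (a i)) + (fun i => kleinEmb (b i)) + fun i => kleinEmb (c i)) =
        (fun _ => ((1 : ZMod 2), (1 : ZMod 2))) ↔ ∀ i, a i ≠ b i ∧ b i ≠ c i ∧ a i ≠ c i := by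
  rw [funext_iff]
  exact forall_congr' fun i => by
    rw [Pi.add_apply, Pi.add_apply]
    exact kleinEmbedding_sum_eq_iff (a i) (b i) (c i)

/-- Sanity corollary: `R(T_{cw,2}^{⊠N}) ≤ 4^N` from the product realization. [new] -/
theorem tensorRank_kroneckerPow_cwTensor_two_le_four_pow (N : ℕ) :
    tensorRank (kroneckerPow (cwTensor ℂ 2) N) ≤ 4 ^ N := by
  have h := tensorRank_kroneckerPow_cwTensor_le_card_of_realization
    (H := Fin N → ZMod 2 × ZMod 2) (fun a i => kleinEmb (a i)) (fun _ => (1, 1))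
    (isXYZRealization_prod N)
  simpa [Fintype.card_pi, Fintype.card_prod, ZMod.card, Finset.prod_const, Finset.card_univ,
    Fintype.card_fin] using h

end Summit.MatrixMultiplication.MatrixMultiplication.Theorems
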